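import Summits.ValiantsHypothesis.ValiantsHypothesis.Theorems.KPlusLogSqLawTridiagonalRealStaticUnitSturmWindowCount
import Summits.ValiantsHypothesis.ValiantsHypothesis.Theorems.KPlusLogSqLawTridiagonalRealStaticUnitExtremeClassDirection

/-!
# Route «KPlusLogSqLaw», crux `WeakLifting` (stmt-ValiantsHypothesis-19561) — REAL side of the tridiagonal sector:
# the UNIT-COEFFICIENT sub-sector — DEFINITE TYPE of the extreme-class zeros on each side of the resonance (all sizes, ANY slope signs)

HONEST FRAMING.  Helper theorems (`--supports stmt-ValiantsHypothesis-19561 --as helper`), seat val-sym-lift-p1 (g18), cell `pub-symmetroid`,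
2026-08-28; companion of `…UnitSturmWindowCount` (negative type from positive slope energy) and `…UnitExtremeClassDirection` (sign of the
balance in the extreme classes).  Continuants `D_k = pathDet (fun _ => 1) d (fun _ => 1) f k`; «type» of a zero in the sense of val-sym-mdr-p2's
inertia kit (`P_u′(t)` for the Rayleigh polynomial of a kernel vector of the evaluated pencil).  Proved here, for all sizes and ALL slope signs:
* `posType_of_slopeEnergy_neg` — the mirror of the core lemma: negative slope energy ⇒ POSITIVE type;
* **TOP CLASS** (alternating pivot products `(−1)^kD_kD_{k+1} > 0`, lift-p2 g9's maximally indefinite pattern): zeros ABOVE the resonance are of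
  NEGATIVE type (`negType_of_alternating_above_one`), zeros BELOW it of POSITIVE type (`posType_of_alternating_below_one`);
* **BOTTOM CLASS** (all pivot products positive — positive semidefinite zeros): BELOW the resonance NEGATIVE type (`negType_of_positive_below_one`:
  exit from positive definiteness), ABOVE it POSITIVE type (`posType_of_positive_above_one`: entry).
Hence on any window whose zeros are all of one extreme class mdr-p2's one-type window laws (`Inertia.card_roots_Ioo_add_negIndex_eq_of_negType` /
`…_of_posType`) count them EXACTLY by the Sturm-count drift — the typed refinement of lift-p2 g9's `Z₀ ≤ 2`, `Z_top ≤ 2` in the unit slice.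
Nothing here is an upper law for the register (α NO MOVER); nothing bears on `WeakLifting` / `TropicalB` (stmt-19771) in their windows, Conjecture B,
the Door-A registers, `MatrixDescartes` (stmt-18050) or VP ≠ VNP.
[this seat; folklore: definite-type eigenvalue crossings]
-/

-- `Summit.ValiantsHypothesis.ValiantsHypothesis.…` repeats a component by the D-0017 layout (single-conjunct summit); the name is mandated.
set_option linter.dupNamespace false
set_option autoImplicit false

namespace Summit.ValiantsHypothesis.ValiantsHypothesis.Theorems.KPlusLogSqLaw
namespace StaticTridiagonalRealUnit

open Real Finset Polynomial Matrix
open Summit.ValiantsHypothesis.ValiantsHypothesis.Theorems.KPlusLogSqLaw.StaticTridiagonalRealPotential (pathDet)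

variable (d : ℕ → ℕ) (f : ℕ → ℕ)

/-! ### 1. Positive type from negative slope energy (mirror of `negType_of_slopeEnergy_pos`) -/

/-- **core, mirrored**: at a zero `t > 0` of `D_{n+2}`, if the slope-weighted energy is NEGATIVE then every non-zero kernel vector `u` of the
evaluated pencil has `P_u′(t) > 0` (positive type). [this file] -/
theorem posType_of_slopeEnergy_neg (n : ℕ) (t : ℝ) (ht : 0 < t)
    (hroot : (pathDet (fun _ => (1 : ℝ)) d (fun _ => (1 : ℝ)) f (n + 2)).eval t = 0)
    (hE : ∑ k ∈ range (n + 1), ((2 * (f k : ℝ)) - ((d k + d (k + 1) : ℕ) : ℝ)) *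
      ((pathDet (fun _ => (1 : ℝ)) d (fun _ => (1 : ℝ)) f k).eval t * (pathDet (fun _ => (1 : ℝ)) d (fun _ => (1 : ℝ)) f (k + 1)).eval t /
        t ^ (2 * ∑ j ∈ range k, f j)) < 0)
    (u : Fin (n + 2) → ℝ) (hu : (∑ κ, t ^ unitExponent d f (n + 2) κ • unitLetter (n + 2) κ) *ᵥ u = 0) (hu0 : u ≠ 0) :
    0 < (derivative (∑ κ, C (u ⬝ᵥ (unitLetter (n + 2) κ *ᵥ u)) * (X : ℝ[X]) ^ unitExponent d f (n + 2) κ)).eval t := by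
  have hker := kernel_eq_smul d f (n + 2) t ht u hu
  set c := u ⟨0, by omega⟩ with hc
  have hc0 : c ≠ 0 := by
    intro h0
    apply hu0
    funext i
    rw [show u i = u ⟨(i : ℕ), i.isLt⟩ from rfl, hker (i : ℕ) i.isLt, ← hc, h0, zero_mul]
    rfl
  have hray := rayleigh_derivative_eval d f (n + 2) u t
  have hdot := dot_pencil (n + 2) (by omega) (fun κ => ((unitExponent d f (n + 2) κ : ℝ) * t ^ unitExponent d f (n + 2) κ)) u
    (fun j => c * ((-1) ^ j * (pathDet (fun _ => (1 : ℝ)) d (fun _ => (1 : ℝ)) f j).eval t / t ^ (∑ i ∈ range j, f i)))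
    (fun j => (d j : ℝ) * t ^ d j) (fun j => (f j : ℝ) * t ^ f j)
    (fun a => by rw [show u a = u ⟨(a : ℕ), a.isLt⟩ from rfl, hker (a : ℕ) a.isLt]) (fun _ => rfl) (fun _ => rfl)
  rw [show n + 2 - 1 = n + 1 from rfl] at hdot
  have hQ := quadForm_eq_neg_slopeEnergy d f n t ht hroot
  have hA : ∑ j ∈ range (n + 2), (d j : ℝ) * t ^ d j *
      (c * ((-1) ^ j * (pathDet (fun _ => (1 : ℝ)) d (fun _ => (1 : ℝ)) f j).eval t / t ^ (∑ i ∈ range j, f i))) ^ 2 =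
      c ^ 2 * ∑ i ∈ range (n + 2), (d i : ℝ) * (t ^ d i *
        ((-1) ^ i * (pathDet (fun _ => (1 : ℝ)) d (fun _ => (1 : ℝ)) f i).eval t / t ^ (∑ j ∈ range i, f j)) ^ 2) := by
    rw [mul_sum]; exact sum_congr rfl fun i _ => by ring
  have hB : ∑ j ∈ range (n + 1), (f j : ℝ) * t ^ f j *
      (c * ((-1) ^ j * (pathDet (fun _ => (1 : ℝ)) d (fun _ => (1 : ℝ)) f j).eval t / t ^ (∑ i ∈ range j, f i))) *
      (c * ((-1) ^ (j + 1) * (pathDet (fun _ => (1 : ℝ)) d (fun _ => (1 : ℝ)) f (j + 1)).eval t / t ^ (∑ i ∈ range (j + 1), f i))) =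
      c ^ 2 * ∑ k ∈ range (n + 1), (f k : ℝ) * (t ^ f k *
        ((-1) ^ k * (pathDet (fun _ => (1 : ℝ)) d (fun _ => (1 : ℝ)) f k).eval t / t ^ (∑ j ∈ range k, f j)) *
        ((-1) ^ (k + 1) * (pathDet (fun _ => (1 : ℝ)) d (fun _ => (1 : ℝ)) f (k + 1)).eval t / t ^ (∑ j ∈ range (k + 1), f j))) := by
    rw [mul_sum]; exact sum_congr rfl fun k _ => by ring
  have hval : t * (derivative (∑ κ, C (u ⬝ᵥ (unitLetter (n + 2) κ *ᵥ u)) * (X : ℝ[X]) ^ unitExponent d f (n + 2) κ)).eval t =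
      c ^ 2 * -∑ k ∈ range (n + 1), ((2 * (f k : ℝ)) - ((d k + d (k + 1) : ℕ) : ℝ)) *
        ((pathDet (fun _ => (1 : ℝ)) d (fun _ => (1 : ℝ)) f k).eval t * (pathDet (fun _ => (1 : ℝ)) d (fun _ => (1 : ℝ)) f (k + 1)).eval t /
          t ^ (2 * ∑ j ∈ range k, f j)) := by
    rw [hray, hdot, ← hQ, hA, hB]; ring
  have hpos : 0 < t * (derivative (∑ κ, C (u ⬝ᵥ (unitLetter (n + 2) κ *ᵥ u)) * (X : ℝ[X]) ^ unitExponent d f (n + 2) κ)).eval t := by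
    rw [hval]
    have hc2 : 0 < c ^ 2 := by positivity
    nlinarith
  exact (pos_iff_pos_of_mul_pos hpos).1 ht

/-! ### 2. The extreme classes have definite type on each side of the resonance (any slope signs) -/

/-- **TOP CLASS above `1` is of NEGATIVE type** (alternating pivot products, any slopes). [this file] -/
theorem negType_of_alternating_above_one (n : ℕ) (hn : 1 ≤ n) (t : ℝ) (ht1 : 1 < t)
    (hroot : (pathDet (fun _ => (1 : ℝ)) d (fun _ => (1 : ℝ)) f (n + 2)).eval t = 0)
    (hnd : ∀ k, 0 < k → k < n + 2 → (pathDet (fun _ => (1 : ℝ)) d (fun _ => (1 : ℝ)) f k).eval t ≠ 0)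
    (halt : ∀ k, k ≤ n → 0 < (-1) ^ k *
      ((pathDet (fun _ => (1 : ℝ)) d (fun _ => (1 : ℝ)) f k).eval t * (pathDet (fun _ => (1 : ℝ)) d (fun _ => (1 : ℝ)) f (k + 1)).eval t))
    (u : Fin (n + 2) → ℝ) (hu : (∑ κ, t ^ unitExponent d f (n + 2) κ • unitLetter (n + 2) κ) *ᵥ u = 0) (hu0 : u ≠ 0) :
    (derivative (∑ κ, C (u ⬝ᵥ (unitLetter (n + 2) κ *ᵥ u)) * (X : ℝ[X]) ^ unitExponent d f (n + 2) κ)).eval t < 0 :=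
  negType_of_slopeEnergy_pos d f n t (one_pos.trans ht1) hroot
    (slopeEnergy_pos_above_one_of_alternating d f n hn t ht1 hroot hnd halt) u hu hu0

/-- **TOP CLASS below `1` is of POSITIVE type** (alternating pivot products, any slopes). [this file] -/
theorem posType_of_alternating_below_one (n : ℕ) (hn : 1 ≤ n) (t : ℝ) (ht : 0 < t) (ht1 : t < 1)
    (hroot : (pathDet (fun _ => (1 : ℝ)) d (fun _ => (1 : ℝ)) f (n + 2)).eval t = 0)
    (hnd : ∀ k, 0 < k → k < n + 2 → (pathDet (fun _ => (1 : ℝ)) d (fun _ => (1 : ℝ)) f k).eval t ≠ 0)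
    (halt : ∀ k, k ≤ n → 0 < (-1) ^ k *
      ((pathDet (fun _ => (1 : ℝ)) d (fun _ => (1 : ℝ)) f k).eval t * (pathDet (fun _ => (1 : ℝ)) d (fun _ => (1 : ℝ)) f (k + 1)).eval t))
    (u : Fin (n + 2) → ℝ) (hu : (∑ κ, t ^ unitExponent d f (n + 2) κ • unitLetter (n + 2) κ) *ᵥ u = 0) (hu0 : u ≠ 0) :
    0 < (derivative (∑ κ, C (u ⬝ᵥ (unitLetter (n + 2) κ *ᵥ u)) * (X : ℝ[X]) ^ unitExponent d f (n + 2) κ)).eval t :=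
  posType_of_slopeEnergy_neg d f n t ht hroot
    (slopeEnergy_neg_below_one_of_alternating d f n hn t ht ht1 hroot hnd halt) u hu hu0

/-- **BOTTOM CLASS below `1` is of NEGATIVE type** (all pivot products positive, any slopes): exit from positive definiteness. [this file] -/
theorem negType_of_positive_below_one (n : ℕ) (hn : 1 ≤ n) (t : ℝ) (ht : 0 < t) (ht1 : t < 1)
    (hroot : (pathDet (fun _ => (1 : ℝ)) d (fun _ => (1 : ℝ)) f (n + 2)).eval t = 0)
    (hnd : ∀ k, 0 < k → k < n + 2 → (pathDet (fun _ => (1 : ℝ)) d (fun _ => (1 : ℝ)) f k).eval t ≠ 0)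
    (hposP : ∀ k, k ≤ n → 0 <
      (pathDet (fun _ => (1 : ℝ)) d (fun _ => (1 : ℝ)) f k).eval t * (pathDet (fun _ => (1 : ℝ)) d (fun _ => (1 : ℝ)) f (k + 1)).eval t)
    (u : Fin (n + 2) → ℝ) (hu : (∑ κ, t ^ unitExponent d f (n + 2) κ • unitLetter (n + 2) κ) *ᵥ u = 0) (hu0 : u ≠ 0) :
    (derivative (∑ κ, C (u ⬝ᵥ (unitLetter (n + 2) κ *ᵥ u)) * (X : ℝ[X]) ^ unitExponent d f (n + 2) κ)).eval t < 0 := by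
  have hbal := balance_pos_of_positive d f n hn t ht hroot hnd hposP
  have hlog : log t < 0 := log_neg ht ht1
  refine negType_of_slopeEnergy_pos d f n t ht hroot ?_ u hu hu0
  have hrw : ∑ k ∈ range (n + 1), (((d k + d (k + 1) : ℕ) : ℝ) - 2 * (f k : ℝ)) * log t *
      ((pathDet (fun _ => (1 : ℝ)) d (fun _ => (1 : ℝ)) f k).eval t * (pathDet (fun _ => (1 : ℝ)) d (fun _ => (1 : ℝ)) f (k + 1)).eval t /
        t ^ (2 * ∑ j ∈ range k, f j)) = (-log t) * ∑ k ∈ range (n + 1), ((2 * (f k : ℝ)) - ((d k + d (k + 1) : ℕ) : ℝ)) *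
      ((pathDet (fun _ => (1 : ℝ)) d (fun _ => (1 : ℝ)) f k).eval t * (pathDet (fun _ => (1 : ℝ)) d (fun _ => (1 : ℝ)) f (k + 1)).eval t /
        t ^ (2 * ∑ j ∈ range k, f j)) := by
    rw [mul_sum]; exact sum_congr rfl fun k _ => by ring
  rw [hrw] at hbal
  exact (pos_iff_pos_of_mul_pos hbal).1 (by linarith)

/-- **BOTTOM CLASS above `1` is of POSITIVE type** (all pivot products positive, any slopes): entry into positive definiteness. [this file] -/
theorem posType_of_positive_above_one (n : ℕ) (hn : 1 ≤ n) (t : ℝ) (ht1 : 1 < t)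
    (hroot : (pathDet (fun _ => (1 : ℝ)) d (fun _ => (1 : ℝ)) f (n + 2)).eval t = 0)
    (hnd : ∀ k, 0 < k → k < n + 2 → (pathDet (fun _ => (1 : ℝ)) d (fun _ => (1 : ℝ)) f k).eval t ≠ 0)
    (hposP : ∀ k, k ≤ n → 0 <
      (pathDet (fun _ => (1 : ℝ)) d (fun _ => (1 : ℝ)) f k).eval t * (pathDet (fun _ => (1 : ℝ)) d (fun _ => (1 : ℝ)) f (k + 1)).eval t)
    (u : Fin (n + 2) → ℝ) (hu : (∑ κ, t ^ unitExponent d f (n + 2) κ • unitLetter (n + 2) κ) *ᵥ u = 0) (hu0 : u ≠ 0) :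
    0 < (derivative (∑ κ, C (u ⬝ᵥ (unitLetter (n + 2) κ *ᵥ u)) * (X : ℝ[X]) ^ unitExponent d f (n + 2) κ)).eval t := by
  have ht : 0 < t := one_pos.trans ht1
  have hbal := balance_pos_of_positive d f n hn t ht hroot hnd hposP
  have hlog : 0 < log t := log_pos ht1
  refine posType_of_slopeEnergy_neg d f n t ht hroot ?_ u hu hu0
  have hrw : ∑ k ∈ range (n + 1), (((d k + d (k + 1) : ℕ) : ℝ) - 2 * (f k : ℝ)) * log t *
      ((pathDet (fun _ => (1 : ℝ)) d (fun _ => (1 : ℝ)) f k).eval t * (pathDet (fun _ => (1 : ℝ)) d (fun _ => (1 : ℝ)) f (k + 1)).eval t /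
        t ^ (2 * ∑ j ∈ range k, f j)) = -(log t * ∑ k ∈ range (n + 1), ((2 * (f k : ℝ)) - ((d k + d (k + 1) : ℕ) : ℝ)) *
      ((pathDet (fun _ => (1 : ℝ)) d (fun _ => (1 : ℝ)) f k).eval t * (pathDet (fun _ => (1 : ℝ)) d (fun _ => (1 : ℝ)) f (k + 1)).eval t /
        t ^ (2 * ∑ j ∈ range k, f j))) := by
    rw [mul_sum, ← sum_neg_distrib]; exact sum_congr rfl fun k _ => by ring
  rw [hrw] at hbal
  have hneg : log t * ∑ k ∈ range (n + 1), ((2 * (f k : ℝ)) - ((d k + d (k + 1) : ℕ) : ℝ)) *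
      ((pathDet (fun _ => (1 : ℝ)) d (fun _ => (1 : ℝ)) f k).eval t * (pathDet (fun _ => (1 : ℝ)) d (fun _ => (1 : ℝ)) f (k + 1)).eval t /
        t ^ (2 * ∑ j ∈ range k, f j)) < 0 := by linarith
  rcases lt_or_ge (∑ k ∈ range (n + 1), ((2 * (f k : ℝ)) - ((d k + d (k + 1) : ℕ) : ℝ)) *
      ((pathDet (fun _ => (1 : ℝ)) d (fun _ => (1 : ℝ)) f k).eval t * (pathDet (fun _ => (1 : ℝ)) d (fun _ => (1 : ℝ)) f (k + 1)).eval t /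
        t ^ (2 * ∑ j ∈ range k, f j))) 0 with h | h
  · exact h
  · exact absurd hneg (not_lt.2 (mul_nonneg hlog.le h))

end StaticTridiagonalRealUnit
end Summit.ValiantsHypothesis.ValiantsHypothesis.Theorems.KPlusLogSqLaw
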